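import Literature.AlgebraicGeometry.Motives.AbelianVarietyInducedActionTwistedCharacter
import Literature.AlgebraicGeometry.Motives.AbelianVarietyInducedActionMackeyFixedPart
import HarnessLib

/-!
# The twisted Mackey formula for `Res_L Ind_H^G Y` and the Frobenius of its fixed part over a finite field:
# `|H| · Σ_{l ∈ L} c(l) Tr(Φ ρ(l) | T_ℓ X) = Σ_{x ∈ G} Σ_{h ∈ H, xhx⁻¹ ∈ L} c(xhx⁻¹) Tr(φ α(h) | T_ℓ Y)` and
# `|H| |L| · Tr(π^m | T_ℓ B_L(Res_L Ind_H^G Y)) = Σ_{x ∈ G} |H ∩ x⁻¹Lx| · Tr(π^m | T_ℓ B_{H ∩ x⁻¹Lx}(Y))`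

`X = ⊕_{t ∈ T} Y_t = Ind_H^G (Y, α)` is an induced action on a power of an abelian variety over a field `K` (bicone `b`,
`Σ_t π_t ≫ ι_t = 𝟙`; `ρ : G → End X`, `ι_t ρ(g) π_u = 0` for `u ≠ g t`; `T` transitive, `H = Stab(t₀)`,
`α(h) = ι_{t₀} ρ(h) π_{t₀}`), `L ≤ G` a subgroup, `Φ = ⊕_t φ` a DIAGONAL `G`-ENDOMORPHISM of `X` (`ι_t ≫ Φ = φ ≫ ι_t`,
`Φ ρ(g) = ρ(g) Φ`; over a finite field `Φ = π_X^m`, `φ = π_Y^m`), `H_x = H ∩ x⁻¹Lx` with norm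
`N_x = Σ_{h ∈ H, xhx⁻¹ ∈ L} α(h)` (`Motives/AbelianVarietyInducedActionMackeyFixedPart`).  Combining the twisted Theorem 12
of `Motives/AbelianVarietyInducedActionTwistedCharacter` with the re-indexing of `Motives/AbelianVarietyInducedActionMackey`
(theorems only, no definition):

* §1 **the twisted Mackey formula** for any weight `c : G → ℤ_ℓ`:
  **`|H| · Σ_{l ∈ L} c(l) Tr(Φ ρ(l) | T_ℓ X) = Σ_{x ∈ G} Σ_{h ∈ H, xhx⁻¹ ∈ L} c(xhx⁻¹) Tr(φ α(h) | T_ℓ Y)`**, its case `c = 1`,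
  and `Tr(φ N_x | T_ℓ Y) = Σ_{h ∈ H, xhx⁻¹ ∈ L} Tr(φ α(h) | T_ℓ Y)`;
* §2 over a FINITE FIELD `𝔽_q`, `ℓ ∤ q`: **`|H| · |L| · Tr(T_ℓ(π_{B_L(X)})^m) = Σ_{x ∈ G} Σ_{h ∈ H, xhx⁻¹ ∈ L} τ_m^Y(h)`**
  (`τ_m^Y(h) = Tr(T_ℓ α(h) ∘ T_ℓ(π_Y)^m)`, `B_L(X) = Im Σ_{l ∈ L} ρ(l)`) and, double coset by double coset,
  **`|H| · |L| · Tr(T_ℓ(π_{B_L(Res_L Ind_H^G Y)})^m) = Σ_{x ∈ G} |H_x| · Tr(T_ℓ(π_{B_{H_x}(Y)})^m)`**, `B_{H_x}(Y) = Im N_x` — the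
  Frobenius traces (zeta function) of the fixed part of the restriction from those of the fixed parts `B_{H ∩ x⁻¹Lx}(Y)`:
  "`L(s, Res_L Ind_H^G χ) = Π_{s ∈ L\G/H} L(s, Ind_{H_s}^L χ^s)`"; at `m = 0` the prequel's dimension formula.

## References

* [SerreLinearRepresentations1977] J.-P. Serre, *Linear Representations of Finite Groups*, GTM 42 (1977): §3.3 Thm. 12, §7.2
  Thm. 13, §7.3 Prop. 22.  Held: `book:serre1977-linear-representations-finite-groups`, PDF pp. 30–31, 50–54 read 2026-08-28.
* [DokchitserEtAl2022] V. Dokchitser, H. Green, A. Konstantinou, A. Morgan, *Parity of ranks of Jacobians of curves*,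
  arXiv:2211.06357, §3 (additive functor lemma) and proof of Thm. 8.4.
* [Milne1986AbelianVarieties] J. S. Milne, *Abelian varieties*, in Cornell–Silverman (1986), §19, proof of Thm. 19.1 (pp. 144–145).
* [KaniRosen1989] E. Kani, M. Rosen, *Idempotent relations and factors of Jacobians*, Math. Ann. 284 (1989), §3 Thm. B, Thm. 3.
* [MumfordAV1970] D. Mumford, *Abelian Varieties* (1970), §19 Thm. 3 (p. 176), Thm. 4 (p. 180).
-/

noncomputable section

open CategoryTheory CategoryTheory.Limits MulAction
open Literature.NumberTheory.DiophantineGeometry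

universe u

namespace Literature.AlgebraicGeometry.Motives

namespace AbelianVariety

namespace Imprimitive

variable {K : Type u} [Field K]

section Reindex

variable {G : Type} [Group G] [Fintype G] {T : Type} [MulAction G T] [DecidableEq T] (t₀ : T)
  [Fintype (stabilizer G t₀)] (L : Subgroup G) [Fintype L] [DecidablePred (· ∈ L)] {R : Type*} [CommRing R]

/-- The re-indexing `h = x⁻¹ l x` (private helper):
`Σ_{l ∈ L} c(l) [x⁻¹lx ∈ Stab(t₀)] Ψ(x⁻¹lx) = Σ_{h ∈ Stab(t₀)} [xhx⁻¹ ∈ L] c(xhx⁻¹) Ψ(h)`. [folklore] -/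
private theorem sum_subgroup_mul_ite_eq_sum_stabilizer' (c Ψ : G → R) (x : G) :
    ∑ l : L, c l * (if (x⁻¹ * l * x) • t₀ = t₀ then Ψ (x⁻¹ * l * x) else 0) =
      ∑ h : stabilizer G t₀, (if x * h * x⁻¹ ∈ L then c (x * h * x⁻¹) * Ψ h else 0) := by
  have hL : ∑ l : L, c l * (if (x⁻¹ * l * x) • t₀ = t₀ then Ψ (x⁻¹ * l * x) else 0) =
      ∑ g : G, (if g ∈ L then c g * (if (x⁻¹ * g * x) • t₀ = t₀ then Ψ (x⁻¹ * g * x) else 0) else 0) := by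
    rw [← Finset.sum_filter]
    exact (Finset.sum_subtype (Finset.univ.filter fun g : G ↦ g ∈ L) (p := fun g ↦ g ∈ L) (fun g ↦ by simp)
      (fun g ↦ c g * (if (x⁻¹ * g * x) • t₀ = t₀ then Ψ (x⁻¹ * g * x) else 0))).symm
  have hR : ∑ h : stabilizer G t₀, (if x * h * x⁻¹ ∈ L then c (x * h * x⁻¹) * Ψ h else 0) =
      ∑ k : G, (if k • t₀ = t₀ then (if x * k * x⁻¹ ∈ L then c (x * k * x⁻¹) * Ψ k else 0) else 0) := by
    conv_rhs => rw [← Finset.sum_filter]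
    exact (Finset.sum_subtype (Finset.univ.filter fun k : G ↦ k • t₀ = t₀) (p := fun k ↦ k ∈ stabilizer G t₀)
      (fun k ↦ by simp [mem_stabilizer_iff]) (fun k ↦ if x * k * x⁻¹ ∈ L then c (x * k * x⁻¹) * Ψ k else 0)).symm
  rw [hL, hR]
  refine Fintype.sum_equiv (MulAut.conj x⁻¹).toEquiv _ _ fun g ↦ ?_
  have hk : x * (x⁻¹ * g * x) * x⁻¹ = g := by group
  simp only [MulEquiv.toEquiv_eq_coe, MulEquiv.coe_toEquiv, MulAut.conj_apply, inv_inv, hk]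
  split_ifs <;> simp

end Reindex

/-! ## §1 The twisted Mackey formula -/

section Twisted

variable (ℓ : ℕ) [Fact ℓ.Prime] {Y : AbelianVariety K} {T : Type} [Fintype T] (b : Bicone (fun _ : T ↦ Y))
  {G : Type} [Group G] [Fintype G] [MulAction G T] [IsPretransitive G T] (ρ : G →* End b.pt) (t₀ : T)
  [Fintype (stabilizer G t₀)] (α : stabilizer G t₀ →* End Y) (L : Subgroup G) [Fintype L] [DecidablePred (· ∈ L)]
  {Φ : b.pt ⟶ b.pt} {φ : Y ⟶ Y}

/-- **The twisted Mackey formula**: for a diagonal `G`-endomorphism `Φ = ⊕ φ` of `X = Ind_H^G Y`, a subgroup `L ≤ G` and any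
weight `c : G → ℤ_ℓ` (`ℓ` invertible in `K`),
**`|H| · Σ_{l ∈ L} c(l) Tr(Φ ρ(l) | T_ℓ X) = Σ_{x ∈ G} Σ_{h ∈ H, xhx⁻¹ ∈ L} c(xhx⁻¹) Tr(φ α(h) | T_ℓ Y)`** (the twisted
Theorem 12 summed over `L` and re-indexed by `h = x⁻¹lx`). [cite: SerreLinearRepresentations1977, §7.3 Prop. 22 and §3.3 Thm. 12]
[cite: MumfordAV1970, §19 Thm. 4 (p. 180)] -/
theorem card_stabilizer_mul_sum_subgroup_mul_trace_comp_eq (hb : ∑ t, b.π t ≫ b.ι t = 𝟙 b.pt)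
    (hρ : ∀ (g : G) (t u : T), g • t ≠ u → b.ι t ≫ End.asHom (ρ g) ≫ b.π u = 0)
    (hΦ : ∀ t, b.ι t ≫ Φ = φ ≫ b.ι t) (hΦρ : ∀ g : G, Φ ≫ End.asHom (ρ g) = End.asHom (ρ g) ≫ Φ) (hℓ : (ℓ : K) ≠ 0)
    (hα : ∀ h : stabilizer G t₀, End.asHom (α h) = b.ι t₀ ≫ End.asHom (ρ h) ≫ b.π t₀) (c : G → ℤ_[ℓ]) :
    (Fintype.card (stabilizer G t₀) : ℤ_[ℓ]) *
        ∑ l : L, c l * LinearMap.trace ℤ_[ℓ] (b.pt.tateModule ℓ) (tateModuleMap ℓ (Φ ≫ End.asHom (ρ l))) =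
      ∑ x : G, ∑ h : stabilizer G t₀, (if x * h * x⁻¹ ∈ L then
        c (x * h * x⁻¹) * LinearMap.trace ℤ_[ℓ] (Y.tateModule ℓ) (tateModuleMap ℓ (φ ≫ End.asHom (α h))) else 0) := by
  classical
  have h12 : ∀ g : G, (Fintype.card (stabilizer G t₀) : ℤ_[ℓ]) *
      LinearMap.trace ℤ_[ℓ] (b.pt.tateModule ℓ) (tateModuleMap ℓ (Φ ≫ End.asHom (ρ g))) =
      ∑ x : G, (if (x⁻¹ * g * x) • t₀ = t₀ then LinearMap.trace ℤ_[ℓ] (Y.tateModule ℓ)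
        (tateModuleMap ℓ (φ ≫ b.ι t₀ ≫ End.asHom (ρ (x⁻¹ * g * x)) ≫ b.π t₀)) else 0) := fun g ↦ by
    rw [← Nat.card_eq_fintype_card]
    exact card_stabilizer_mul_trace_tateModuleMap_comp_asHom_eq_sum ℓ b ρ t₀ hb hρ hΦ hΦρ hℓ g
  calc (Fintype.card (stabilizer G t₀) : ℤ_[ℓ]) *
        ∑ l : L, c l * LinearMap.trace ℤ_[ℓ] (b.pt.tateModule ℓ) (tateModuleMap ℓ (Φ ≫ End.asHom (ρ l)))
      = ∑ l : L, c l * ((Fintype.card (stabilizer G t₀) : ℤ_[ℓ]) *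
          LinearMap.trace ℤ_[ℓ] (b.pt.tateModule ℓ) (tateModuleMap ℓ (Φ ≫ End.asHom (ρ l)))) := by
        rw [Finset.mul_sum]
        exact Finset.sum_congr rfl fun l _ ↦ by ring
    _ = ∑ l : L, c l * ∑ x : G, (if (x⁻¹ * l * x) • t₀ = t₀ then LinearMap.trace ℤ_[ℓ] (Y.tateModule ℓ)
          (tateModuleMap ℓ (φ ≫ b.ι t₀ ≫ End.asHom (ρ (x⁻¹ * l * x)) ≫ b.π t₀)) else 0) :=
        Finset.sum_congr rfl fun l _ ↦ by rw [h12]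
    _ = ∑ l : L, ∑ x : G, c l * (if (x⁻¹ * l * x) • t₀ = t₀ then LinearMap.trace ℤ_[ℓ] (Y.tateModule ℓ)
          (tateModuleMap ℓ (φ ≫ b.ι t₀ ≫ End.asHom (ρ (x⁻¹ * l * x)) ≫ b.π t₀)) else 0) :=
        Finset.sum_congr rfl fun l _ ↦ Finset.mul_sum _ _ _
    _ = ∑ x : G, ∑ l : L, c l * (if (x⁻¹ * l * x) • t₀ = t₀ then LinearMap.trace ℤ_[ℓ] (Y.tateModule ℓ)
          (tateModuleMap ℓ (φ ≫ b.ι t₀ ≫ End.asHom (ρ (x⁻¹ * l * x)) ≫ b.π t₀)) else 0) := Finset.sum_comm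
    _ = ∑ x : G, ∑ h : stabilizer G t₀, (if x * h * x⁻¹ ∈ L then
          c (x * h * x⁻¹) * LinearMap.trace ℤ_[ℓ] (Y.tateModule ℓ) (tateModuleMap ℓ (φ ≫ End.asHom (α h))) else 0) := by
        refine Finset.sum_congr rfl fun x _ ↦ ?_
        rw [sum_subgroup_mul_ite_eq_sum_stabilizer' t₀ L c (fun k ↦ LinearMap.trace ℤ_[ℓ] (Y.tateModule ℓ)
          (tateModuleMap ℓ (φ ≫ b.ι t₀ ≫ End.asHom (ρ k) ≫ b.π t₀))) x]
        exact Finset.sum_congr rfl fun h _ ↦ by rw [hα h]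

/-- The weight `c = 1`: **`|H| · Σ_{l ∈ L} Tr(Φ ρ(l) | T_ℓ X) = Σ_{x ∈ G} Σ_{h ∈ H, xhx⁻¹ ∈ L} Tr(φ α(h) | T_ℓ Y)`**.
[cite: SerreLinearRepresentations1977, §7.3 Prop. 22 and §3.3 Thm. 12] -/
theorem card_stabilizer_mul_sum_subgroup_trace_comp_eq (hb : ∑ t, b.π t ≫ b.ι t = 𝟙 b.pt)
    (hρ : ∀ (g : G) (t u : T), g • t ≠ u → b.ι t ≫ End.asHom (ρ g) ≫ b.π u = 0)
    (hΦ : ∀ t, b.ι t ≫ Φ = φ ≫ b.ι t) (hΦρ : ∀ g : G, Φ ≫ End.asHom (ρ g) = End.asHom (ρ g) ≫ Φ) (hℓ : (ℓ : K) ≠ 0)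
    (hα : ∀ h : stabilizer G t₀, End.asHom (α h) = b.ι t₀ ≫ End.asHom (ρ h) ≫ b.π t₀) :
    (Fintype.card (stabilizer G t₀) : ℤ_[ℓ]) *
        ∑ l : L, LinearMap.trace ℤ_[ℓ] (b.pt.tateModule ℓ) (tateModuleMap ℓ (Φ ≫ End.asHom (ρ l))) =
      ∑ x : G, ∑ h : stabilizer G t₀, (if x * h * x⁻¹ ∈ L then
        LinearMap.trace ℤ_[ℓ] (Y.tateModule ℓ) (tateModuleMap ℓ (φ ≫ End.asHom (α h))) else 0) := by
  have h := card_stabilizer_mul_sum_subgroup_mul_trace_comp_eq ℓ b ρ t₀ α L hb hρ hΦ hΦρ hℓ hα (fun _ ↦ 1)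
  simpa only [one_mul] using h

omit [Fintype T] [Fintype G] [IsPretransitive G T] [Fintype L] in
/-- **`Tr(φ N_x | T_ℓ Y) = Σ_{h ∈ H, xhx⁻¹ ∈ L} Tr(φ α(h) | T_ℓ Y)`** for the norm `N_x = Σ_{h ∈ H, xhx⁻¹ ∈ L} α(h)` of `H_x = H ∩ x⁻¹Lx`
and any endomorphism `φ` of `Y`. [cite: MumfordAV1970, §19 Thm. 3 (p. 176)] [cite: KaniRosen1989, §3 Thm. B] -/
theorem trace_tateModuleMap_comp_normInter_eq_sum {N : G → (Y ⟶ Y)}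
    (hN : ∀ x : G, End.of (N x) = ∑ h : stabilizer G t₀, if x * h * x⁻¹ ∈ L then α h else 0) (φ : Y ⟶ Y) (x : G) :
    LinearMap.trace ℤ_[ℓ] (Y.tateModule ℓ) (tateModuleMap ℓ (φ ≫ N x)) =
      ∑ h : stabilizer G t₀, (if x * h * x⁻¹ ∈ L then
        LinearMap.trace ℤ_[ℓ] (Y.tateModule ℓ) (tateModuleMap ℓ (φ ≫ End.asHom (α h))) else 0) := by
  have h : N x = ∑ h : stabilizer G t₀, (if x * h * x⁻¹ ∈ L then End.asHom (α h) else 0) := hN x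
  rw [h, Preadditive.comp_sum, tateModuleMap_sum, map_sum]
  exact Finset.sum_congr rfl fun k _ ↦ by split_ifs <;> simp [tateModuleMap_zero]

end Twisted

/-! ## §2 Finite field: the Frobenius of `B_L(Res_L Ind_H^G Y)` double coset by double coset -/

section Frobenius

variable [Finite K] (ℓ : ℕ) [Fact ℓ.Prime] {Y : AbelianVariety K} {T : Type} [Fintype T] (b : Bicone (fun _ : T ↦ Y))
  {G : Type} [Group G] [Fintype G] [MulAction G T] [IsPretransitive G T] (ρ : G →* End b.pt) (t₀ : T)
  [Fintype (stabilizer G t₀)] (α : stabilizer G t₀ →* End Y) (L : Subgroup G) [Fintype L] [DecidablePred (· ∈ L)]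

/-- `T_ℓ(π_X^m ≫ f) = T_ℓ f ∘ T_ℓ(π_X)^m` (the `τ_m` convention of `Motives/AbelianVarietyFactorFrobeniusTraces`). [cite: MumfordAV1970, §19 Thm. 3 (p. 176)] -/
private theorem tateModuleMap_frobeniusHom_pow_comp' {X Z : AbelianVariety K} (f : X ⟶ Z) (m : ℕ) :
    tateModuleMap ℓ (((End.of (frobeniusHom X) ^ m : End X) : X ⟶ X) ≫ f) =
      tateModuleMap ℓ f ∘ₗ tateModuleMap ℓ (frobeniusHom X) ^ m := by
  rw [tateModuleMap_comp, tateModuleMap_end_pow]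

/-- **`|H| · |L| · Tr(T_ℓ(π_{B_L(X)})^m | T_ℓ B_L(X)) = Σ_{x ∈ G} Σ_{h ∈ H, xhx⁻¹ ∈ L} Tr(T_ℓ α(h) ∘ T_ℓ(π_Y)^m | T_ℓ Y)`** over a
finite field `𝔽_q`, `ℓ ∤ q`, for `B_L(X) = Im N_L`, `N_L = Σ_{l ∈ L} ρ(l)`, `X = Ind_H^G Y`: the Frobenius traces of the fixed part
of the restriction from the `H`-twisted Frobenius traces of `Y` (`|L| Tr(π_{B_L}^m) = Σ_l τ_m^X(l)` and the twisted Mackey formula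
with `c = 1`). [cite: DokchitserEtAl2022, §3 and proof of Thm. 8.4] [cite: SerreLinearRepresentations1977, §7.3 Prop. 22]
[cite: Milne1986AbelianVarieties, §19, proof of Thm. 19.1 (pp. 144–145)] -/
theorem card_stabilizer_mul_card_mul_trace_frobeniusHom_pow_image_norm_eq_sum (hb : ∑ t, b.π t ≫ b.ι t = 𝟙 b.pt)
    (hρ : ∀ (g : G) (t u : T), g • t ≠ u → b.ι t ≫ End.asHom (ρ g) ≫ b.π u = 0) (hℓ : (ℓ : K) ≠ 0)
    (hα : ∀ h : stabilizer G t₀, End.asHom (α h) = b.ι t₀ ≫ End.asHom (ρ h) ≫ b.π t₀)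
    {NL : b.pt ⟶ b.pt} (hNL : End.of NL = ∑ l : L, ρ l) (m : ℕ) :
    (Fintype.card (stabilizer G t₀) : ℤ_[ℓ]) * (Fintype.card L : ℤ_[ℓ]) *
        LinearMap.trace ℤ_[ℓ] ((image NL).tateModule ℓ) (tateModuleMap ℓ (frobeniusHom (image NL)) ^ m) =
      ∑ x : G, ∑ h : stabilizer G t₀, (if x * h * x⁻¹ ∈ L then LinearMap.trace ℤ_[ℓ] (Y.tateModule ℓ)
        (tateModuleMap ℓ (End.asHom (α h)) ∘ₗ tateModuleMap ℓ (frobeniusHom Y) ^ m) else 0) := by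
  have hL := trace_tateModuleMap_frobeniusHom_pow_comp_eq ℓ (norm_comp_norm_eq_card_nsmul ρ hNL) hℓ m
  have hNL' : NL = ∑ l : L, End.asHom (ρ l) := hNL
  have hs : LinearMap.trace ℤ_[ℓ] (b.pt.tateModule ℓ)
      (tateModuleMap ℓ (((End.of (frobeniusHom b.pt) ^ m : End b.pt) : b.pt ⟶ b.pt) ≫ NL)) =
      ∑ l : L, LinearMap.trace ℤ_[ℓ] (b.pt.tateModule ℓ)
        (tateModuleMap ℓ (((End.of (frobeniusHom b.pt) ^ m : End b.pt) : b.pt ⟶ b.pt) ≫ End.asHom (ρ l))) := by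
    conv_lhs => rw [hNL', Preadditive.comp_sum, tateModuleMap_sum, map_sum]
  have hM := card_stabilizer_mul_sum_subgroup_trace_comp_eq ℓ b ρ t₀ α L hb hρ
    (Φ := ((End.of (frobeniusHom b.pt) ^ m : End b.pt) : b.pt ⟶ b.pt))
    (φ := ((End.of (frobeniusHom Y) ^ m : End Y) : Y ⟶ Y))
    (fun t ↦ (frobeniusHom_pow_comp (b.ι t) m).symm) (fun g ↦ frobeniusHom_pow_comp (End.asHom (ρ g)) m) hℓ hα
  rw [← hs, hL, ← mul_assoc] at hM
  rw [hM]
  refine Finset.sum_congr rfl fun x _ ↦ Finset.sum_congr rfl fun h _ ↦ ?_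
  split_ifs
  · rw [tateModuleMap_frobeniusHom_pow_comp']
  · rfl

/-- **The Frobenius of `B_L(Res_L Ind_H^G Y)` double coset by double coset**: over a finite field `𝔽_q`, `ℓ ∤ q`, for every `m`,
**`|H| · |L| · Tr(T_ℓ(π_{B_L(X)})^m) = Σ_{x ∈ G} |H_x| · Tr(T_ℓ(π_{B_{H_x}(Y)})^m)`** with `H_x = H ∩ x⁻¹Lx`, `B_{H_x}(Y) = Im N_x`,
`N_x = Σ_{h ∈ H, xhx⁻¹ ∈ L} α(h)` (`Σ_{h ∈ H_x} τ_m^Y(h) = Tr(π_Y^m N_x) = |H_x| Tr(π_{Im N_x}^m)`): the `ℓ`-adic form of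
"`L(s, Res_L Ind_H^G χ) = Π_{s ∈ L\G/H} L(s, Ind_{H_s}^L χ^s)`" for the fixed parts; at `m = 0` the dimension formula of
`Motives/AbelianVarietyInducedActionMackeyFixedPart`. [cite: SerreLinearRepresentations1977, §7.3 Prop. 22]
[cite: DokchitserEtAl2022, §3 and proof of Thm. 8.4] [cite: KaniRosen1989, §3 Thm. B] -/
theorem card_stabilizer_mul_card_mul_trace_frobeniusHom_pow_image_norm_eq_sum_natCard_mul (hb : ∑ t, b.π t ≫ b.ι t = 𝟙 b.pt)
    (hρ : ∀ (g : G) (t u : T), g • t ≠ u → b.ι t ≫ End.asHom (ρ g) ≫ b.π u = 0) (hℓ : (ℓ : K) ≠ 0)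
    (hα : ∀ h : stabilizer G t₀, End.asHom (α h) = b.ι t₀ ≫ End.asHom (ρ h) ≫ b.π t₀)
    {NL : b.pt ⟶ b.pt} (hNL : End.of NL = ∑ l : L, ρ l) {N : G → (Y ⟶ Y)}
    (hN : ∀ x : G, End.of (N x) = ∑ h : stabilizer G t₀, if x * h * x⁻¹ ∈ L then α h else 0) (m : ℕ) :
    (Fintype.card (stabilizer G t₀) : ℤ_[ℓ]) * (Fintype.card L : ℤ_[ℓ]) *
        LinearMap.trace ℤ_[ℓ] ((image NL).tateModule ℓ) (tateModuleMap ℓ (frobeniusHom (image NL)) ^ m) =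
      ∑ x : G, (Nat.card ((L.comap (MulAut.conj x).toMonoidHom).subgroupOf (stabilizer G t₀)) : ℤ_[ℓ]) *
        LinearMap.trace ℤ_[ℓ] ((image (N x)).tateModule ℓ) (tateModuleMap ℓ (frobeniusHom (image (N x))) ^ m) := by
  rw [card_stabilizer_mul_card_mul_trace_frobeniusHom_pow_image_norm_eq_sum ℓ b ρ t₀ α L hb hρ hℓ hα hNL m]
  refine Finset.sum_congr rfl fun x _ ↦ ?_
  rw [← trace_tateModuleMap_frobeniusHom_pow_comp_eq ℓ (normInter_comp_normInter_eq_natCard_nsmul t₀ α L hN x) hℓ m,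
    trace_tateModuleMap_comp_normInter_eq_sum ℓ t₀ α L hN _ x]
  refine Finset.sum_congr rfl fun h _ ↦ ?_
  split_ifs
  · rw [tateModuleMap_frobeniusHom_pow_comp']
  · rfl

end Frobenius

end Imprimitive

end AbelianVariety

end Literature.AlgebraicGeometry.Motives
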